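import Mathlib
import HarnessLib
import Summits.ResolutionOfSingularities.ResolutionOfSingularities.Theorems.WildQuotientsWildQuotientResolutionS1aKillPowerChains
import Summits.ResolutionOfSingularities.ResolutionOfSingularities.Theorems.WildQuotientsWildQuotientResolutionS1aTriangularShiftKillsIn
import Summits.ResolutionOfSingularities.ResolutionOfSingularities.Theorems.WildQuotientsWildQuotientResolutionS1aA1Root

/-!
# S1a — THE SYMMETRIC ROOT MOVE OF THE LINE-ARRANGEMENT CLASS, ring level: centre (x₀ : δ+1, x₁ : 1, x₂ : 1), shift `δ`, `g = s^δ`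

[OURS · L1 W4.5c · lead-1 g14; plan-1 RULING R-F15k (b4) / lead-1 ANSWER Q-R3: «the symmetric root (x₀ : d+1, x₁ : 1, x₂ : 1; δ = d) separates all d planes at once»;
pattern ✓`…S1aD4Root` (asymmetric root (x₀:2, x₁:1))] — NOT statements of the manuscript; counted 0; AI-level work, weaker than expert review. Crux
stmt-ResolutionOfSingularities-17941 `CyclicQuotientFourfolds`, line `s1a-logminvertex` v13 (`stub_reachLowerInFX`). Pure algebra through `e : A ≃ k[x₀..x₃]`.

Datum: `σ` fixing constants and `x₀`, `σx₁ = x₁ + x₀`, `σx₂ = x₂ + x₀`, `σx₃ = x₃ + x₁·r` with the tail factor `r ∈ 𝒥_{δ−1}((x₀, x₁, x₂); (δ+1, 1, 1))` (for L_d: `r = ∏_{i≥2} ℓᵢ`,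
`δ = d`; a1: `r = x₂`, `δ = 2`; D₄: `r = x₂(x₁ − x₂)`, `δ = 3`). Centre `f = (e⁻¹x₀, e⁻¹x₁, e⁻¹x₂)`, weights `(δ+1, 1, 1)`, `τ = e⁻¹ σ e`.
* `sym_admissible` — (a′)_δ with `β = 1`: `y ∈ 𝒥ₙ ⇒ τy − y ∈ 𝒥ₙ₊δ` (rows x₁, x₂ ↦ x₀ ∈ 𝒥_{δ+1}, x₃ ↦ x₁r ∈ 𝒥_δ); `sym_map_le` (σ-adaptedness);
* `sym_augmentationIdeal_sigmaR_le` — (H1) `augIdeal σ_R ≤ (s^δ)`;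
* `sym_sigmaR_u'_one_sub` / `sym_sigmaR_u'_two_sub` — `σ_R uⱼ′ − uⱼ′ = s^δ·u₀′` (`j = 1, 2`); `sym_u'_zero_mem_residual` — `u₀′ ∈ 𝔞 := (augIdeal σ_R : s^δ)`;
* `sym_sigmaR_algebraMap_three_sub` — `σ_R x₃ − x₃ = s^δ · (u₁′ · (r t^{δ−1}))`; `sym_u'_one_mul_mem_residual` — `u₁′·(r t^{δ−1}) ∈ 𝔞`: the residual on the charts
  `N(x₁)`, `N(x₂)` is `V(u₀′) ∩ V(u₁′ · r t^{δ−1})` — for L_d the DISJOINT union of the strict transforms of the d planes;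
* K1′: `sym_isRegular`, `sym_isRegularRing_quotient` (three distinct variables through `e`).
-/

set_option linter.dupNamespace false

noncomputable section

open Literature.AlgebraicGeometry.Resolution
open scoped LaurentPolynomial
open MvPolynomial
open Summit.ResolutionOfSingularities.ResolutionOfSingularities.Theorems.WildQuotientResolution.S1.CoarseChart
open Summit.ResolutionOfSingularities.ResolutionOfSingularities.Theorems.WildQuotientResolution.S1.GameFrame.GModel

namespace Summit.ResolutionOfSingularities.ResolutionOfSingularities.Theorems.WildQuotientResolution.S1.KillCert.Sym

variable {k : Type} [Field k] {A : Type} [CommRing A]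
  (σ : MvPolynomial (Fin 4) k ≃+* MvPolynomial (Fin 4) k) (hC : ∀ a : k, σ (C a) = C a)
  (h0 : σ (X 0) = X 0) (h1 : σ (X 1) = X 1 + X 0) (h2 : σ (X 2) = X 2 + X 0) (δ : ℕ) (r : MvPolynomial (Fin 4) k)
  (h3 : σ (X 3) = X 3 + X 1 * r)
  (e : A ≃+* MvPolynomial (Fin 4) k) (τ : A ≃+* A) (hact : ∀ t : A, τ t = e.symm (σ (e t)))
  (hr : e.symm r ∈ (weightedFiltration (e.symm ∘ ![X 0, X 1, X 2] : Fin 3 → A) ![δ + 1, 1, 1]).ideal (δ - 1)) (hδ : 1 ≤ δ)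

/-! ## K1′ -/

/-- `(e⁻¹x₀, e⁻¹x₁, e⁻¹x₂)` is a regular sequence on `A`. -/
theorem sym_isRegular : RingTheory.Sequence.IsRegular A (List.ofFn (e.symm ∘ ![X 0, X 1, X 2] : Fin 3 → A)) := by
  have h : (e.symm ∘ ![X 0, X 1, X 2] : Fin 3 → A) = ⇑e.symm ∘ ((X : Fin 4 → MvPolynomial (Fin 4) k) ∘ ![0, 1, 2]) := by
    funext i; fin_cases i <;> rfl
  rw [h]
  exact IsRegular.of_ringEquiv_ofFn e.symm _ (isRegular_X_comp k (![0, 1, 2] : Fin 3 → Fin 4) (by decide))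

/-- `A/(e⁻¹x₀, e⁻¹x₁, e⁻¹x₂)` is regular. -/
theorem sym_isRegularRing_quotient : IsRegularRing (A ⧸ Ideal.span (Set.range (e.symm ∘ ![X 0, X 1, X 2] : Fin 3 → A))) := by
  have h : (e.symm ∘ ![X 0, X 1, X 2] : Fin 3 → A) = ⇑e.symm ∘ ((X : Fin 4 → MvPolynomial (Fin 4) k) ∘ ![0, 1, 2]) := by
    funext i; fin_cases i <;> rfl
  rw [h]
  exact isRegularRing_quotient_of_ringEquiv e.symm _ (isRegularRing_quotient_X_comp k (![0, 1, 2] : Fin 3 → Fin 4))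

/-! ## (a′)_δ -/

include hC h0 h1 h2 h3 hact hr hδ in
/-- **(a′)_δ for the symmetric root**: `y ∈ 𝒥ₙ ⇒ τy − y ∈ (1)·𝒥ₙ₊δ`. [OURS · L1 W4.5c · symmetric root] -/
theorem sym_admissible : ∀ (n : ℕ) (y : A), y ∈ (weightedFiltration (e.symm ∘ ![X 0, X 1, X 2] : Fin 3 → A) ![δ + 1, 1, 1]).ideal n →
    τ y - y ∈ Ideal.span {(1 : A)} * (weightedFiltration (e.symm ∘ ![X 0, X 1, X 2] : Fin 3 → A) ![δ + 1, 1, 1]).ideal (n + δ) := by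
  have hf0 : (e.symm ∘ ![X 0, X 1, X 2] : Fin 3 → A) 0 = e.symm (X 0) := rfl
  have hf1 : (e.symm ∘ ![X 0, X 1, X 2] : Fin 3 → A) 1 = e.symm (X 1) := rfl
  have hf2 : (e.symm ∘ ![X 0, X 1, X 2] : Fin 3 → A) 2 = e.symm (X 2) := rfl
  have hX0 : e.symm (X 0) ∈ (weightedFiltration (e.symm ∘ ![X 0, X 1, X 2] : Fin 3 → A) ![δ + 1, 1, 1]).ideal (δ + 1) :=
    mem_weightedFiltration_ideal (e.symm ∘ ![X 0, X 1, X 2] : Fin 3 → A) ![δ + 1, 1, 1] 0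
  have hX1 : e.symm (X 1) ∈ (weightedFiltration (e.symm ∘ ![X 0, X 1, X 2] : Fin 3 → A) ![δ + 1, 1, 1]).ideal 1 :=
    mem_weightedFiltration_ideal (e.symm ∘ ![X 0, X 1, X 2] : Fin 3 → A) ![δ + 1, 1, 1] 1
  have h1J : ∀ {m : ℕ} {z : A}, z ∈ (weightedFiltration (e.symm ∘ ![X 0, X 1, X 2] : Fin 3 → A) ![δ + 1, 1, 1]).ideal m →
      z ∈ Ideal.span {(1 : A)} * (weightedFiltration (e.symm ∘ ![X 0, X 1, X 2] : Fin 3 → A) ![δ + 1, 1, 1]).ideal m :=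
    fun hz => by rw [Ideal.span_singleton_one, Ideal.top_mul]; exact hz
  have hgen : Subring.closure (e.symm '' (Set.range (C : k → MvPolynomial (Fin 4) k) ∪ Set.range (X : Fin 4 → MvPolynomial (Fin 4) k))) = ⊤ := by
    show Subring.closure ((e.symm : MvPolynomial (Fin 4) k →+* A) '' _) = ⊤
    rw [← RingHom.map_closure, closure_range_C_union_range_X_of k (Fin 4), ← RingHom.range_eq_map]
    exact RingHom.range_eq_top.mpr e.symm.surjective
  have hx1r : e.symm (X 1 * r) ∈ (weightedFiltration (e.symm ∘ ![X 0, X 1, X 2] : Fin 3 → A) ![δ + 1, 1, 1]).ideal δ := by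
    rw [map_mul]
    have h := (weightedFiltration (e.symm ∘ ![X 0, X 1, X 2] : Fin 3 → A) ![δ + 1, 1, 1]).mul_le 1 (δ - 1) (Ideal.mul_mem_mul hX1 hr)
    rwa [show 1 + (δ - 1) = δ by omega] at h
  refine admissible_shift_of_generators (e.symm ∘ ![X 0, X 1, X 2] : Fin 3 → A) ![δ + 1, 1, 1] τ δ 1 _ hgen ?_ ?_
  · rintro _ ⟨g, hg | hg, rfl⟩
    · obtain ⟨a, rfl⟩ := hg
      rw [A1.act_symm σ e τ hact, hC, sub_self]; exact Ideal.zero_mem _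
    · obtain ⟨i, rfl⟩ := hg
      refine h1J ?_
      fin_cases i
      · rw [Fin.zero_eta, A1.act_symm σ e τ hact, h0, sub_self]; exact Ideal.zero_mem _
      · rw [Fin.mk_one, A1.act_symm σ e τ hact, h1, map_add, add_sub_cancel_left]
        exact (weightedFiltration _ _).antitone (by omega) hX0
      · change τ (e.symm (X 2)) - e.symm (X 2) ∈ _
        rw [A1.act_symm σ e τ hact, h2, map_add, add_sub_cancel_left]
        exact (weightedFiltration _ _).antitone (by omega) hX0
      · change τ (e.symm (X 3)) - e.symm (X 3) ∈ _
        rw [A1.act_symm σ e τ hact, h3, map_add, add_sub_cancel_left]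
        exact hx1r
  · intro i
    refine h1J ?_
    fin_cases i
    · change τ (e.symm (X 0)) - e.symm (X 0) ∈ _
      rw [A1.act_symm σ e τ hact, h0, sub_self]; exact Ideal.zero_mem _
    · change τ (e.symm (X 1)) - e.symm (X 1) ∈ (weightedFiltration (e.symm ∘ ![X 0, X 1, X 2] : Fin 3 → A) ![δ + 1, 1, 1]).ideal (1 + δ)
      rw [A1.act_symm σ e τ hact, h1, map_add, add_sub_cancel_left, Nat.add_comm 1 δ]; exact hX0
    · change τ (e.symm (X 2)) - e.symm (X 2) ∈ (weightedFiltration (e.symm ∘ ![X 0, X 1, X 2] : Fin 3 → A) ![δ + 1, 1, 1]).ideal (1 + δ)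
      rw [A1.act_symm σ e τ hact, h2, map_add, add_sub_cancel_left, Nat.add_comm 1 δ]; exact hX0

include hC h0 h1 h2 h3 hact hr hδ in
/-- σ-adaptedness of the symmetric centre. -/
theorem sym_map_le : ∀ n : ℕ, ((weightedFiltration (e.symm ∘ ![X 0, X 1, X 2] : Fin 3 → A) ![δ + 1, 1, 1]).ideal n).map (τ : A →+* A) ≤
    (weightedFiltration (e.symm ∘ ![X 0, X 1, X 2] : Fin 3 → A) ![δ + 1, 1, 1]).ideal n :=
  fun n => map_le_of_admissible_shift _ _ τ δ 1 (sym_admissible σ hC h0 h1 h2 δ r h3 e τ hact hr hδ) n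

/-! ## (H1) and the residual ideal -/

section Residual

variable {p : ℕ} (hp : 0 < p) (hσp : ∀ x : A, (⇑τ)^[p] x = x)

include hC h0 h1 h2 h3 hact hr hδ in
/-- **(H1)**: every increment `σ_R z − z` is a multiple of `s^δ`. [OURS · L1 W4.5c · symmetric root] -/
theorem sym_augmentationIdeal_sigmaR_le
    (hσJ : ∀ n : ℕ, ((weightedFiltration (e.symm ∘ ![X 0, X 1, X 2] : Fin 3 → A) ![δ + 1, 1, 1]).ideal n).map (τ : A →+* A) ≤
      (weightedFiltration (e.symm ∘ ![X 0, X 1, X 2] : Fin 3 → A) ![δ + 1, 1, 1]).ideal n) :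
    augmentationIdeal (sigmaR τ (e.symm ∘ ![X 0, X 1, X 2] : Fin 3 → A) ![δ + 1, 1, 1] hσJ hp hσp) ≤
      Ideal.span {cobordantAlgebra.s (e.symm ∘ ![X 0, X 1, X 2] : Fin 3 → A) ![δ + 1, 1, 1] ^ δ} := by
  have h := augmentationIdeal_sigmaR_le_span_of_admissible_shift (e.symm ∘ ![X 0, X 1, X 2] : Fin 3 → A) ![δ + 1, 1, 1] τ hσJ hp hσp δ 1
    (sym_admissible σ hC h0 h1 h2 δ r h3 e τ hact hr hδ)
  rwa [map_one, one_mul] at h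

include h1 hact in
/-- `σ_R u₁′ − u₁′ = s^δ · u₀′`. -/
theorem sym_sigmaR_u'_one_sub
    (hσJ : ∀ n : ℕ, ((weightedFiltration (e.symm ∘ ![X 0, X 1, X 2] : Fin 3 → A) ![δ + 1, 1, 1]).ideal n).map (τ : A →+* A) ≤
      (weightedFiltration (e.symm ∘ ![X 0, X 1, X 2] : Fin 3 → A) ![δ + 1, 1, 1]).ideal n) :
    sigmaR τ (e.symm ∘ ![X 0, X 1, X 2] : Fin 3 → A) ![δ + 1, 1, 1] hσJ hp hσp (cobordantAlgebra.u' _ _ 1) - cobordantAlgebra.u' _ _ 1 =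
      cobordantAlgebra.s (e.symm ∘ ![X 0, X 1, X 2] : Fin 3 → A) ![δ + 1, 1, 1] ^ δ * cobordantAlgebra.u' _ _ 0 := by
  have hyj : τ (e.symm (X 1)) - e.symm (X 1) = 1 * e.symm (X 0) := by rw [A1.act_symm σ e τ hact, h1, map_add]; ring
  have h := sigmaR_sub_eq_of_admissible_shift (e.symm ∘ ![X 0, X 1, X 2] : Fin 3 → A) ![δ + 1, 1, 1] τ hσJ hp hσp δ 1 (n := 1) hyj
    (cobordantAlgebra.u' _ _ 1) (cobordantAlgebra.u' _ _ 0) (by rw [cobordantAlgebra.coe_u']; rfl)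
    (by rw [cobordantAlgebra.coe_u']; change LaurentPolynomial.C (e.symm (X 0)) * LaurentPolynomial.T ((δ + 1 : ℕ) : ℤ) = _; rw [Nat.add_comm δ 1])
  rw [h, map_one, one_mul]

include h2 hact in
/-- `σ_R u₂′ − u₂′ = s^δ · u₀′`. -/
theorem sym_sigmaR_u'_two_sub
    (hσJ : ∀ n : ℕ, ((weightedFiltration (e.symm ∘ ![X 0, X 1, X 2] : Fin 3 → A) ![δ + 1, 1, 1]).ideal n).map (τ : A →+* A) ≤
      (weightedFiltration (e.symm ∘ ![X 0, X 1, X 2] : Fin 3 → A) ![δ + 1, 1, 1]).ideal n) :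
    sigmaR τ (e.symm ∘ ![X 0, X 1, X 2] : Fin 3 → A) ![δ + 1, 1, 1] hσJ hp hσp (cobordantAlgebra.u' _ _ 2) - cobordantAlgebra.u' _ _ 2 =
      cobordantAlgebra.s (e.symm ∘ ![X 0, X 1, X 2] : Fin 3 → A) ![δ + 1, 1, 1] ^ δ * cobordantAlgebra.u' _ _ 0 := by
  have hyj : τ (e.symm (X 2)) - e.symm (X 2) = 1 * e.symm (X 0) := by rw [A1.act_symm σ e τ hact, h2, map_add]; ring
  have h := sigmaR_sub_eq_of_admissible_shift (e.symm ∘ ![X 0, X 1, X 2] : Fin 3 → A) ![δ + 1, 1, 1] τ hσJ hp hσp δ 1 (n := 1) hyj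
    (cobordantAlgebra.u' _ _ 2) (cobordantAlgebra.u' _ _ 0) (by rw [cobordantAlgebra.coe_u']; rfl)
    (by rw [cobordantAlgebra.coe_u']; change LaurentPolynomial.C (e.symm (X 0)) * LaurentPolynomial.T ((δ + 1 : ℕ) : ℤ) = _; rw [Nat.add_comm δ 1])
  rw [h, map_one, one_mul]

include h1 hact in
/-- ★ `u₀′ ∈ 𝔞 := (augIdeal σ_R : s^δ)`: the `[x₀]`-chart is KILLED. -/
theorem sym_u'_zero_mem_residual
    (hσJ : ∀ n : ℕ, ((weightedFiltration (e.symm ∘ ![X 0, X 1, X 2] : Fin 3 → A) ![δ + 1, 1, 1]).ideal n).map (τ : A →+* A) ≤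
      (weightedFiltration (e.symm ∘ ![X 0, X 1, X 2] : Fin 3 → A) ![δ + 1, 1, 1]).ideal n) :
    cobordantAlgebra.u' (e.symm ∘ ![X 0, X 1, X 2] : Fin 3 → A) ![δ + 1, 1, 1] 0 ∈
      (augmentationIdeal (sigmaR τ (e.symm ∘ ![X 0, X 1, X 2] : Fin 3 → A) ![δ + 1, 1, 1] hσJ hp hσp)).colon
        (Ideal.span {cobordantAlgebra.s (e.symm ∘ ![X 0, X 1, X 2] : Fin 3 → A) ![δ + 1, 1, 1] ^ δ}) := by
  rw [Ideal.mem_colon_span_singleton, mul_comm, ← sym_sigmaR_u'_one_sub σ h1 δ e τ hact hp hσp hσJ]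
  exact sub_mem_augmentationIdeal _ _

include h3 hact hr hδ in
/-- `σ_R x₃ − x₃ = s^δ · (u₁′ · (r t^{δ−1}))`. -/
theorem sym_sigmaR_algebraMap_three_sub
    (hσJ : ∀ n : ℕ, ((weightedFiltration (e.symm ∘ ![X 0, X 1, X 2] : Fin 3 → A) ![δ + 1, 1, 1]).ideal n).map (τ : A →+* A) ≤
      (weightedFiltration (e.symm ∘ ![X 0, X 1, X 2] : Fin 3 → A) ![δ + 1, 1, 1]).ideal n) :
    sigmaR τ (e.symm ∘ ![X 0, X 1, X 2] : Fin 3 → A) ![δ + 1, 1, 1] hσJ hp hσp (algebraMap A _ (e.symm (X 3))) - algebraMap A _ (e.symm (X 3)) =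
      cobordantAlgebra.s (e.symm ∘ ![X 0, X 1, X 2] : Fin 3 → A) ![δ + 1, 1, 1] ^ δ *
        (cobordantAlgebra.u' (e.symm ∘ ![X 0, X 1, X 2] : Fin 3 → A) ![δ + 1, 1, 1] 1 * ⟨_, C_mul_T_mem_cobordantAlgebra _ _ hr⟩) := by
  have hyj : τ (e.symm (X 3)) - e.symm (X 3) = 1 * (e.symm (X 1) * e.symm r) := by
    rw [A1.act_symm σ e τ hact, h3, map_add, map_mul]; ring
  have hz' : ((cobordantAlgebra.u' (e.symm ∘ ![X 0, X 1, X 2] : Fin 3 → A) ![δ + 1, 1, 1] 1 * ⟨_, C_mul_T_mem_cobordantAlgebra _ _ hr⟩ :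
      ↥(cobordantAlgebra (e.symm ∘ ![X 0, X 1, X 2] : Fin 3 → A) ![δ + 1, 1, 1])) : A[T;T⁻¹]) =
      LaurentPolynomial.C (e.symm (X 1) * e.symm r) * LaurentPolynomial.T ((0 + δ : ℕ) : ℤ) := by
    rw [MulMemClass.coe_mul, cobordantAlgebra.coe_u', map_mul]
    change LaurentPolynomial.C (e.symm (X 1)) * LaurentPolynomial.T ((1 : ℕ) : ℤ) * (LaurentPolynomial.C (e.symm r) * LaurentPolynomial.T ((δ - 1 : ℕ) : ℤ)) = _
    rw [mul_assoc, mul_left_comm (LaurentPolynomial.T _), ← mul_assoc, ← LaurentPolynomial.T_add]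
    congr 2
    push_cast [hδ]
    ring
  have h := sigmaR_sub_eq_of_admissible_shift (e.symm ∘ ![X 0, X 1, X 2] : Fin 3 → A) ![δ + 1, 1, 1] τ hσJ hp hσp δ 1 (n := 0) hyj
    (algebraMap A _ (e.symm (X 3))) _ (by rw [cobordantAlgebra.coe_algebraMap, Nat.cast_zero, LaurentPolynomial.T_zero, mul_one]) hz'
  rw [h, map_one, one_mul]

include h3 hact hr hδ in
/-- ★ `u₁′ · (r t^{δ−1}) ∈ 𝔞`: the residual on the charts `N(x₁)`, `N(x₂)` lies in `V(u₀′) ∩ V(u₁′ · r t^{δ−1})`. -/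
theorem sym_u'_one_mul_mem_residual
    (hσJ : ∀ n : ℕ, ((weightedFiltration (e.symm ∘ ![X 0, X 1, X 2] : Fin 3 → A) ![δ + 1, 1, 1]).ideal n).map (τ : A →+* A) ≤
      (weightedFiltration (e.symm ∘ ![X 0, X 1, X 2] : Fin 3 → A) ![δ + 1, 1, 1]).ideal n) :
    cobordantAlgebra.u' (e.symm ∘ ![X 0, X 1, X 2] : Fin 3 → A) ![δ + 1, 1, 1] 1 * ⟨_, C_mul_T_mem_cobordantAlgebra _ _ hr⟩ ∈
      (augmentationIdeal (sigmaR τ (e.symm ∘ ![X 0, X 1, X 2] : Fin 3 → A) ![δ + 1, 1, 1] hσJ hp hσp)).colon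
        (Ideal.span {cobordantAlgebra.s (e.symm ∘ ![X 0, X 1, X 2] : Fin 3 → A) ![δ + 1, 1, 1] ^ δ}) := by
  rw [Ideal.mem_colon_span_singleton, mul_comm, ← sym_sigmaR_algebraMap_three_sub σ δ r h3 e τ hact hr hδ hp hσp hσJ]
  exact sub_mem_augmentationIdeal _ _

end Residual

end Summit.ResolutionOfSingularities.ResolutionOfSingularities.Theorems.WildQuotientResolution.S1.KillCert.Sym

end
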